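import Summits.ResolutionOfSingularities.ResolutionOfSingularities.Theorems.PurelyInseparableDim4ResConeDInfTT
import Summits.ResolutionOfSingularities.ResolutionOfSingularities.Theorems.PurelyInseparableDim4ResConeSliceA
import HarnessLib
import HarnessLib.Audit.Tags

/-!
# Purely inseparable four-folds — THE «GOOD» INVARIANT OF A BINARY-CONE TAIL: at most two boundary letters, every boundary pair TT —
# and the one-step TT bookkeeping of its failure (every prime `p`, every shade; K2(p) lane, SLICE C, `(p, p−1)` rung; file-holder
# res-dim4-p-5 g5)

[OURS · counted 0 · cell `res-dim4-pi` · K2(p) lane, slice C (general-`p` programme; bus plan res-dim4-p-5 g5 2026-08-29 08:32Z «every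
(p, p−1) binary-cone tail is eventually GOOD») · seat p-5 g5.]  Nothing here proves K2(p) for any `p`, `NoIsolatedTrap p p` or
resolution of singularities in dimension ≥ 4 / characteristic `p` — NOT proved.  AI kernel work, weaker than expert review.

On a constant-`(d, e_G = 2)` tail (witnessed isolated above-floor `Step0 p` chain, `x^{r₀} ∣ F₀`), write `S_m` for the boundary letters
(`1 ≤ r_m i`), `D_m = direction (j m) (b m) ∈ Vtx(m)` for the step direction, «`i` KEPT at step `m`» for `i ≠ j m ∧ b m i = 0`
(equivalently `D_m i = 0`), and «TT(x, y) at `m`» for: no non-zero vector of `Vtx(m) = resVertex (c m)` vanishes at `x` and `y`.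
GOOD(m) := «at most two boundary letters at `m`, and every pair of boundary letters is TT».  This file is the one-step bookkeeping:
* `succ_r_apply_of_ne'`, `one_le_succ_r_chart`, `eq_chart_of_single` — the boundary law letterwise; the newborn weighs `≥ 1`; a lone
  boundary letter is the last newborn;
* **`not_kept_both_of_tt`** — a TT pair cannot be kept by one step (the direction would vanish on both letters);
* **`tt_transport_kept`** — TT(x, y) at `m`, `y` kept, `x` hit ⇒ TT(j m, y) at `m + 1` (`tt_succ` if `x` is the chart, `tt_move` with the
  frame vector `D_m / D_m x` otherwise);
* **`kept_of_kept_newborn`** — if TT(j (m−1), o) FAILS at `m` and the step keeps the newborn `j (m−1)`, it keeps `o` as well (the kept-newborn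
  direction is the kernel line `Vtx(m) ∩ H_{j (m−1)}`, `chain_satellite_direction_eq_smul`, which is spanned by the degenerate vector);
* **`good_succ`** — «every boundary pair TT at `m + 1`» ⇒ GOOD(m + 2) (every `p`, every shade `d`, `e_G ≡ 2`);
* **`noGood_step`** — the NO-GOOD dynamics: with a letter `z` fixed, a SHAPE-2 state `{j m, z}` or a SHAPE-3 state `{a, b′, z}` with TT(a, b′)
  at `m + 1`, GOOD failing at `m + 1` and `m + 2`, steps KEEPING `z` to a state of one of the two shapes (same `z`).
The `(p, p−1)` ledger and the assembly «eventually GOOD» are `…ResConeEventuallyGoodPrime`.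
[cite: CossartJannsenSaito2020, Thm. 3.10(4), Thm. 3.14, Thm. 9.3] [cite: HauserPerlega2019PRIMS, §2 (transform D′ of D)]
bears_on: LADDER-RESOLUTION:D157-DOOR2 (res-dim4-pi · K2(p) = `RidgeBudget.NoAboveFloorTrap p p` · slice C, the GOOD invariant).
Supports stmt-ResolutionOfSingularities-16155 (helper).
-/

set_option linter.dupNamespace false -- mandated namespace of this single-conjunct summit

noncomputable section

namespace Summit.ResolutionOfSingularities.ResolutionOfSingularities.Theorems.PIDim4

namespace ResCone

open MvPolynomial Finset
open Literature.AlgebraicGeometry.Resolution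
open Literature.AlgebraicGeometry.Resolution.CentreBlowup
open Literature.AlgebraicGeometry.Resolution.Hauser2010
open Literature.AlgebraicGeometry.Resolution.HauserPerlega2019
open PointBlowup (direction)

variable {K : Type} [Field K] [DecidableEq K] (p : ℕ) [Fact p.Prime]

section Ledger

/-- The boundary law at a non-chart letter: a kept letter keeps its weight, a translated one is lost. [OURS · bookkeeping]
[cite: HauserPerlega2019PRIMS, §2 (transform D′ of D)] -/
theorem succ_r_apply_of_ne' {c : ℕ → State K} {j : ℕ → Fin 4} {b : ℕ → Fin 4 → K}
    (hc : ∀ k, IsIsolated p (c k).F ∧ Step0 p (c k) (c (k + 1))) (hw : FreeTail.IsWitnessedChain p c j b)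
    (hfloor : ∀ k, ordZero (c k).F ≠ p) (m : ℕ) {i : Fin 4} (hij : i ≠ j m) :
    (c (m + 1)).r i = if b m i = 0 then (c m).r i else 0 := by
  obtain ⟨o, ho, -, -⟩ := chain_band p hc hfloor m
  rw [(hw m).2.2.2.2, step_r_univ' p (j m) (b m) (c m) ho, Finsupp.coe_update, Function.update_of_ne hij,
    Finsupp.filter_apply]

/-- The newborn letter weighs `o − p ≥ 1`. [OURS · bookkeeping] [cite: HauserPerlega2019PRIMS, §2 (transform D′ of D)] -/
theorem one_le_succ_r_chart {c : ℕ → State K} {j : ℕ → Fin 4} {b : ℕ → Fin 4 → K}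
    (hc : ∀ k, IsIsolated p (c k).F ∧ Step0 p (c k) (c (k + 1))) (hw : FreeTail.IsWitnessedChain p c j b)
    (hfloor : ∀ k, ordZero (c k).F ≠ p) (m : ℕ) : 1 ≤ (c (m + 1)).r (j m) := by
  obtain ⟨o, ho, hpo, -⟩ := chain_band p hc hfloor m
  rw [(hw m).2.2.2.2, step_r_univ' p (j m) (b m) (c m) ho, Finsupp.coe_update, Function.update_self]
  omega

/-- A lone boundary letter is the last newborn. [OURS · bookkeeping] [cite: HauserPerlega2019PRIMS, §2 (transform D′ of D)] -/
theorem eq_chart_of_single {c : ℕ → State K} {j : ℕ → Fin 4} {b : ℕ → Fin 4 → K}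
    (hc : ∀ k, IsIsolated p (c k).F ∧ Step0 p (c k) (c (k + 1))) (hw : FreeTail.IsWitnessedChain p c j b)
    (hfloor : ∀ k, ordZero (c k).F ≠ p) (m : ℕ) {z : Fin 4} (hsingle : ∀ i, i ≠ z → (c (m + 1)).r i = 0) : j m = z := by
  by_contra h
  have := one_le_succ_r_chart p hc hw hfloor m
  rw [hsingle (j m) h] at this
  omega

end Ledger

section TT

/-- **A TT PAIR CANNOT BE KEPT BY ONE STEP**: on the constant-`(d, e_G = 2)` tail, if TT(x, y) holds at `m ≥ k₀` then the step does not keep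
both `x` and `y` (its direction lies in the kernel and would vanish at `x` and `y`). [OURS]
[cite: CossartJannsenSaito2020, Thm. 3.10(4), Thm. 3.14] -/
theorem not_kept_both_of_tt {c : ℕ → State K} {j : ℕ → Fin 4} {b : ℕ → Fin 4 → K}
    (hc : ∀ k, IsIsolated p (c k).F ∧ Step0 p (c k) (c (k + 1))) (hw : FreeTail.IsWitnessedChain p c j b)
    (hr0 : ∀ e ∈ (c 0).F.support, (c 0).r ≤ e) (hfloor : ∀ k, ordZero (c k).F ≠ p) {k₀ : ℕ} {d : ℕ∞}
    (hshade : ∀ k, k₀ ≤ k → (c k).shade = d) {m : ℕ} (hm : k₀ ≤ m) {x y : Fin 4}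
    (hTT : ∀ v ∈ resVertex (c m), v x = 0 → v y = 0 → v = 0) (hx : x ≠ j m) (hbx : b m x = 0) (hy : y ≠ j m)
    (hby : b m y = 0) : False := by
  have hD := chain_direction_mem_resVertex p hc hw hr0 hfloor hshade hm
  have h0 := hTT _ hD (by rw [direction_apply_of_ne hx, hbx]) (by rw [direction_apply_of_ne hy, hby])
  have h1 := congrFun h0 (j m)
  rw [direction_apply_self, Pi.zero_apply] at h1
  exact one_ne_zero h1

/-- **TT TRANSPORT WHEN ONE LETTER IS KEPT AND THE OTHER HIT**: TT(x, y) at `m ≥ k₀`, `y` kept (`y ≠ j m`, `b m y = 0`) and `x` hit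
(`x = j m` or `b m x ≠ 0`) ⇒ TT(j m, y) at `m + 1` (`tt_succ` when `x` is the chart, `tt_move` with the frame vector `D_m / b m x` otherwise).
[OURS] [cite: CossartJannsenSaito2020, Thm. 3.10(4), Thm. 3.14, Thm. 9.3] -/
theorem tt_transport_kept {c : ℕ → State K} {j : ℕ → Fin 4} {b : ℕ → Fin 4 → K}
    (hc : ∀ k, IsIsolated p (c k).F ∧ Step0 p (c k) (c (k + 1))) (hw : FreeTail.IsWitnessedChain p c j b)
    (hr0 : ∀ e ∈ (c 0).F.support, (c 0).r ≤ e) (hfloor : ∀ k, ordZero (c k).F ≠ p) {k₀ : ℕ} {d : ℕ∞}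
    (hshade : ∀ k, k₀ ≤ k → (c k).shade = d) (he : ∀ k, k₀ ≤ k → Module.finrank K (resVertex (c k)) = 2)
    {m : ℕ} (hm : k₀ ≤ m) {x y : Fin 4} (hxy : x ≠ y) (hTT : ∀ v ∈ resVertex (c m), v x = 0 → v y = 0 → v = 0)
    (hy : y ≠ j m) (hby : b m y = 0) (hx : x = j m ∨ b m x ≠ 0) :
    ∀ v ∈ resVertex (c (m + 1)), v (j m) = 0 → v y = 0 → v = 0 := by
  by_cases hxj : x = j m
  · subst hxj
    exact tt_succ p hc hw hr0 hfloor hshade he hm hTT (Or.inl rfl)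
  · have hbx : b m x ≠ 0 := hx.resolve_left hxj
    have hD := chain_direction_mem_resVertex p hc hw hr0 hfloor hshade hm
    have hφa : ((b m x)⁻¹ • direction (j m) (b m) - (Pi.single x 1 : Fin 4 → K)) x = 0 := by
      simp only [Pi.sub_apply, Pi.smul_apply, smul_eq_mul, Pi.single_eq_same, direction_apply_of_ne hxj,
        inv_mul_cancel₀ hbx, sub_self]
    have hφy : ((b m x)⁻¹ • direction (j m) (b m) - (Pi.single x 1 : Fin 4 → K)) y = 0 := by
      simp only [Pi.sub_apply, Pi.smul_apply, smul_eq_mul, Pi.single_eq_of_ne hxy.symm, direction_apply_of_ne hy, hby,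
        mul_zero, sub_zero]
    have hφV : (Pi.single x 1 : Fin 4 → K) + ((b m x)⁻¹ • direction (j m) (b m) - (Pi.single x 1 : Fin 4 → K)) ∈
        resVertex (c m) := by
      rw [add_sub_cancel]
      exact Submodule.smul_mem _ _ hD
    have hφg : ((b m x)⁻¹ • direction (j m) (b m) - (Pi.single x 1 : Fin 4 → K)) (j m) ≠ 0 := by
      simp only [Pi.sub_apply, Pi.smul_apply, smul_eq_mul, Pi.single_eq_of_ne (Ne.symm hxj), direction_apply_self, mul_one,
        sub_zero]
      exact inv_ne_zero hbx
    exact tt_move p hc hw hr0 hfloor hshade he (Ne.symm hxj) hm hTT hφa hφy hφV hφg rfl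

/-- **KEEPING THE NEWBORN OF A DEGENERATE PAIR KEEPS THE OTHER LETTER**: at `m + 1` (`m ≥ k₀`), if some non-zero kernel vector vanishes at
the newborn `j m` and at `o`, and step `m + 1` keeps `j m` (a satellite step), then its direction is a multiple of that vector, so it
vanishes at `o` too: `o` is kept (`o ≠ j (m+1)`, `b (m+1) o = 0`). [OURS] [cite: CossartJannsenSaito2020, Thm. 3.10(4), Thm. 3.14, Thm. 9.3] -/
theorem kept_of_kept_newborn {c : ℕ → State K} {j : ℕ → Fin 4} {b : ℕ → Fin 4 → K}
    (hc : ∀ k, IsIsolated p (c k).F ∧ Step0 p (c k) (c (k + 1))) (hw : FreeTail.IsWitnessedChain p c j b)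
    (hr0 : ∀ e ∈ (c 0).F.support, (c 0).r ≤ e) (hfloor : ∀ k, ordZero (c k).F ≠ p) {k₀ : ℕ} {d : ℕ∞}
    (hshade : ∀ k, k₀ ≤ k → (c k).shade = d) (he : ∀ k, k₀ ≤ k → Module.finrank K (resVertex (c k)) = 2)
    {m : ℕ} (hm : k₀ ≤ m) {o : Fin 4} {w : Fin 4 → K} (hwV : w ∈ resVertex (c (m + 1))) (hw0 : w ≠ 0)
    (hwℓ : w (j m) = 0) (hwo : w o = 0) (hsat : FreeTail.IsSatellite j b m) :
    o ≠ j (m + 1) ∧ b (m + 1) o = 0 := by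
  have hwV' : w ∈ resVertex (c m) := (mem_resVertex_iff_of_apply_chart_eq_zero p hc hw hr0 hfloor hshade he hm hwℓ).mp hwV
  obtain ⟨hne, hdir⟩ := chain_satellite_direction_eq_smul p hc hw hr0 hfloor hshade hm hsat (he m hm).le hwV' hwℓ hw0
  have hDo : direction (j (m + 1)) (b (m + 1)) o = 0 := by rw [hdir, Pi.smul_apply, hwo, smul_zero]
  have hoj : o ≠ j (m + 1) := by
    intro h
    rw [h, direction_apply_self] at hDo
    exact one_ne_zero hDo
  exact ⟨hoj, by rwa [direction_apply_of_ne hoj] at hDo⟩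

/-- **GOOD PASSES TO THE NEXT STATE** (every prime, every shade, `e_G ≡ 2`): if at `m + 1` (`m ≥ k₀`) every pair of boundary letters
is TT, then at `m + 2` there are at most two boundary letters and every pair of them is TT (the support bound is not even needed
at `m + 1`).  (A TT pair cannot be kept, so at most one old letter
survives next to the newborn `j (m+1)`; its TT with the newborn is `tt_transport_kept` if another boundary letter was hit, and
`tt_of_satellite` if it was alone — a lone boundary letter is the previous newborn `j m`, and keeping it is a satellite step.) [OURS]
[cite: CossartJannsenSaito2020, Thm. 3.10(4), Thm. 3.14, Thm. 9.3] -/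
theorem good_succ {c : ℕ → State K} {j : ℕ → Fin 4} {b : ℕ → Fin 4 → K}
    (hc : ∀ k, IsIsolated p (c k).F ∧ Step0 p (c k) (c (k + 1))) (hw : FreeTail.IsWitnessedChain p c j b)
    (hr0 : ∀ e ∈ (c 0).F.support, (c 0).r ≤ e) (hfloor : ∀ k, ordZero (c k).F ≠ p) {k₀ : ℕ} {d : ℕ∞}
    (hshade : ∀ k, k₀ ≤ k → (c k).shade = d) (he : ∀ k, k₀ ≤ k → Module.finrank K (resVertex (c k)) = 2)
    {m : ℕ} (hm : k₀ ≤ m)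
    (hTT : ∀ x y : Fin 4, x ≠ y → 1 ≤ (c (m + 1)).r x → 1 ≤ (c (m + 1)).r y →
      ∀ v ∈ resVertex (c (m + 1)), v x = 0 → v y = 0 → v = 0) :
    (∃ x y : Fin 4, ∀ i, i ≠ x → i ≠ y → (c (m + 2)).r i = 0) ∧
    (∀ x y : Fin 4, x ≠ y → 1 ≤ (c (m + 2)).r x → 1 ≤ (c (m + 2)).r y →
      ∀ v ∈ resVertex (c (m + 2)), v x = 0 → v y = 0 → v = 0) := by
  have hm1 : k₀ ≤ m + 1 := by omega
  have hlaw := fun i (hi : i ≠ j (m + 1)) => succ_r_apply_of_ne' p hc hw hfloor (m + 1) hi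
  -- a boundary letter of `m + 2` other than the newborn is a KEPT boundary letter of `m + 1`
  have hold : ∀ i, i ≠ j (m + 1) → 1 ≤ (c (m + 2)).r i → 1 ≤ (c (m + 1)).r i ∧ b (m + 1) i = 0 := by
    intro i hi h1
    rw [hlaw i hi] at h1
    by_cases hb : b (m + 1) i = 0
    · rw [if_pos hb] at h1; exact ⟨h1, hb⟩
    · rw [if_neg hb] at h1; omega
  -- at most one kept boundary letter
  have hone : ∀ i i', i ≠ j (m + 1) → i' ≠ j (m + 1) → 1 ≤ (c (m + 2)).r i → 1 ≤ (c (m + 2)).r i' → i = i' := by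
    intro i i' hi hi' h1 h1'
    by_contra hii
    obtain ⟨hri, hbi⟩ := hold i hi h1
    obtain ⟨hri', hbi'⟩ := hold i' hi' h1'
    exact not_kept_both_of_tt p hc hw hr0 hfloor hshade hm1 (hTT i i' hii hri hri') hi hbi hi' hbi'
  refine ⟨?_, ?_⟩
  · -- support: the newborn and at most one kept letter
    by_cases hex : ∃ i, i ≠ j (m + 1) ∧ 1 ≤ (c (m + 2)).r i
    · obtain ⟨i₀, hi₀, h1⟩ := hex
      refine ⟨j (m + 1), i₀, fun i hi hi' => ?_⟩
      by_contra hne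
      exact hi' (hone i i₀ hi hi₀ (by omega) h1)
    · push Not at hex
      refine ⟨j (m + 1), j (m + 1), fun i hi _ => ?_⟩
      have := hex i hi; omega
  · -- TT for the boundary pairs of `m + 2`
    intro x y hxy hx hy
    -- one of them is the newborn
    have hnew : x = j (m + 1) ∨ y = j (m + 1) := by
      by_contra hno; push Not at hno
      exact hxy (hone x y hno.1 hno.2 hx hy)
    -- reduce to `x = j (m+1)`, `y` kept
    suffices H : ∀ y : Fin 4, y ≠ j (m + 1) → 1 ≤ (c (m + 2)).r y →
        ∀ v ∈ resVertex (c (m + 2)), v (j (m + 1)) = 0 → v y = 0 → v = 0 by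
      rcases hnew with hxj | hyj
      · rw [hxj] at hxy ⊢; exact H y (Ne.symm hxy) hy
      · rw [hyj] at hxy ⊢
        intro v hv hvx hvj
        exact H x hxy hx v hv hvj hvx
    intro y hyj hy1
    obtain ⟨hry, hby⟩ := hold y hyj hy1
    -- was `y` alone at `m + 1`, or was another boundary letter hit?
    by_cases halone : ∀ i, i ≠ y → (c (m + 1)).r i = 0
    · -- `y` alone: it is the newborn `j m`, kept ⇒ satellite ⇒ TT reborn
      have hjy : j m = y := eq_chart_of_single p hc hw hfloor m halone
      have hsat : FreeTail.IsSatellite j b m := ⟨by rw [hjy]; exact Ne.symm hyj, by rw [hjy]; exact hby⟩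
      have h := tt_of_satellite p hc hw hr0 hfloor hshade he hm hsat
      rw [hjy] at h
      intro v hv hvj hvy
      exact h v hv hvy hvj
    · push Not at halone
      obtain ⟨x', hx'y, hrx'⟩ := halone
      have hrx'1 : 1 ≤ (c (m + 1)).r x' := by omega
      -- `x'` is hit (else two kept letters)
      have hhit : x' = j (m + 1) ∨ b (m + 1) x' ≠ 0 := by
        by_contra hno; push Not at hno
        exact not_kept_both_of_tt p hc hw hr0 hfloor hshade hm1 (hTT x' y hx'y hrx'1 hry) hno.1 hno.2 hyj hby
      exact tt_transport_kept p hc hw hr0 hfloor hshade he hm1 hx'y (hTT x' y hx'y hrx'1 hry) hyj hby hhit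

/-- **THE NO-GOOD STEP** (every prime, every shade, `e_G ≡ 2`).  Fix a letter `z`.  Suppose that at `m + 1` (`m ≥ k₀`) the boundary is
EITHER the pair `{j m, z}` (SHAPE 2) OR a triple `{a, b′, z}` with TT(a, b′) (SHAPE 3), and that GOOD fails at `m + 1` and at `m + 2`.
Then step `m + 1` KEEPS `z`, and the boundary at `m + 2` is again of SHAPE 2 (`{j (m+1), z}`) or SHAPE 3 (with the same `z`).
(Keeping the newborn of a degenerate pair keeps `z`: `kept_of_kept_newborn`; a TT pair is never kept: `not_kept_both_of_tt`; every
other continuation is GOOD by `tt_transport_kept` / `tt_of_satellite`.) [OURS]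
[cite: CossartJannsenSaito2020, Thm. 3.10(4), Thm. 3.14, Thm. 9.3] -/
theorem noGood_step {c : ℕ → State K} {j : ℕ → Fin 4} {b : ℕ → Fin 4 → K}
    (hc : ∀ k, IsIsolated p (c k).F ∧ Step0 p (c k) (c (k + 1))) (hw : FreeTail.IsWitnessedChain p c j b)
    (hr0 : ∀ e ∈ (c 0).F.support, (c 0).r ≤ e) (hfloor : ∀ k, ordZero (c k).F ≠ p) {k₀ : ℕ} {d : ℕ∞}
    (hshade : ∀ k, k₀ ≤ k → (c k).shade = d) (he : ∀ k, k₀ ≤ k → Module.finrank K (resVertex (c k)) = 2)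
    {m : ℕ} (hm : k₀ ≤ m) {z : Fin 4}
    (hshape : ((z ≠ j m ∧ 1 ≤ (c (m + 1)).r z ∧ ∀ i, i ≠ j m → i ≠ z → (c (m + 1)).r i = 0) ∨
      (∃ a b' : Fin 4, a ≠ b' ∧ a ≠ z ∧ b' ≠ z ∧ 1 ≤ (c (m + 1)).r a ∧ 1 ≤ (c (m + 1)).r b' ∧ 1 ≤ (c (m + 1)).r z ∧
        (∀ i, i ≠ a → i ≠ b' → i ≠ z → (c (m + 1)).r i = 0) ∧
        ∀ v ∈ resVertex (c (m + 1)), v a = 0 → v b' = 0 → v = 0)))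
    (hbad1 : ¬ ((∃ x y : Fin 4, ∀ i, i ≠ x → i ≠ y → (c (m + 1)).r i = 0) ∧
        (∀ x y : Fin 4, x ≠ y → 1 ≤ (c (m + 1)).r x → 1 ≤ (c (m + 1)).r y →
          ∀ v ∈ resVertex (c (m + 1)), v x = 0 → v y = 0 → v = 0)))
    (hbad2 : ¬ ((∃ x y : Fin 4, ∀ i, i ≠ x → i ≠ y → (c (m + 2)).r i = 0) ∧
        (∀ x y : Fin 4, x ≠ y → 1 ≤ (c (m + 2)).r x → 1 ≤ (c (m + 2)).r y →
          ∀ v ∈ resVertex (c (m + 2)), v x = 0 → v y = 0 → v = 0))) :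
    (z ≠ j (m + 1) ∧ b (m + 1) z = 0) ∧
    ((z ≠ j (m + 1) ∧ 1 ≤ (c (m + 2)).r z ∧ ∀ i, i ≠ j (m + 1) → i ≠ z → (c (m + 2)).r i = 0) ∨
      (∃ a b' : Fin 4, a ≠ b' ∧ a ≠ z ∧ b' ≠ z ∧ 1 ≤ (c (m + 2)).r a ∧ 1 ≤ (c (m + 2)).r b' ∧ 1 ≤ (c (m + 2)).r z ∧
        (∀ i, i ≠ a → i ≠ b' → i ≠ z → (c (m + 2)).r i = 0) ∧
        ∀ v ∈ resVertex (c (m + 2)), v a = 0 → v b' = 0 → v = 0)) := by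
  have hm1 : k₀ ≤ m + 1 := by omega
  have hlaw := fun i (hi : i ≠ j (m + 1)) => succ_r_apply_of_ne' p hc hw hfloor (m + 1) hi
  have hnew : 1 ≤ (c (m + 2)).r (j (m + 1)) := one_le_succ_r_chart p hc hw hfloor (m + 1)
  -- letters that are `0` at `m + 1` or hit at step `m + 1` are `0` at `m + 2`
  have hzero : ∀ i, i ≠ j (m + 1) → ((c (m + 1)).r i = 0 ∨ b (m + 1) i ≠ 0) → (c (m + 2)).r i = 0 := by
    intro i hi h
    rw [hlaw i hi]
    rcases h with h | h
    · rw [h, ite_self]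
    · rw [if_neg h]
  have hkeep : ∀ i, i ≠ j (m + 1) → b (m + 1) i = 0 → (c (m + 2)).r i = (c (m + 1)).r i := fun i hi hb => by
    rw [hlaw i hi, if_pos hb]
  -- GOOD at `m + 2` from a support inside `{j (m+1), y}` with TT(j (m+1), y)
  have hG2 : ∀ y : Fin 4, (∀ i, i ≠ j (m + 1) → i ≠ y → (c (m + 2)).r i = 0) →
      (∀ v ∈ resVertex (c (m + 2)), v (j (m + 1)) = 0 → v y = 0 → v = 0) → ((∃ x y : Fin 4, ∀ i, i ≠ x → i ≠ y → (c (m + 2)).r i = 0) ∧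
        (∀ x y : Fin 4, x ≠ y → 1 ≤ (c (m + 2)).r x → 1 ≤ (c (m + 2)).r y →
          ∀ v ∈ resVertex (c (m + 2)), v x = 0 → v y = 0 → v = 0)) := by
    intro y hsupp hTT
    refine ⟨⟨j (m + 1), y, hsupp⟩, fun x x' hxx' hx hx' => ?_⟩
    have hmem : ∀ u, 1 ≤ (c (m + 2)).r u → u = j (m + 1) ∨ u = y := by
      intro u hu; by_contra hno; push Not at hno; have := hsupp u hno.1 hno.2; omega
    intro v hv hvx hvx'
    rcases hmem x hx with rfl | rfl <;> rcases hmem x' hx' with h | h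
    · exact absurd h.symm hxx'
    · subst h; exact hTT v hv hvx hvx'
    · subst h; exact hTT v hv hvx' hvx
    · exact absurd (h ▸ rfl : x' = x) hxx'.symm
  have hG1 : (∀ i, i ≠ j (m + 1) → (c (m + 2)).r i = 0) → ((∃ x y : Fin 4, ∀ i, i ≠ x → i ≠ y → (c (m + 2)).r i = 0) ∧
        (∀ x y : Fin 4, x ≠ y → 1 ≤ (c (m + 2)).r x → 1 ≤ (c (m + 2)).r y →
          ∀ v ∈ resVertex (c (m + 2)), v x = 0 → v y = 0 → v = 0)) := by
    intro hsupp
    refine ⟨⟨j (m + 1), j (m + 1), fun i hi _ => hsupp i hi⟩, fun x x' hxx' hx hx' => ?_⟩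
    have hmem : ∀ u, 1 ≤ (c (m + 2)).r u → u = j (m + 1) := by
      intro u hu; by_contra hno; have := hsupp u hno; omega
    exact absurd ((hmem x hx).trans (hmem x' hx').symm) hxx'
  rcases hshape with ⟨hzj, hz1, hoth⟩ | ⟨a, b', hab, haz, hbz, ha1, hb1, hz1, hoth, hTT⟩
  · -- SHAPE 2 at `m + 1`: boundary `{{ℓ := j m, z}}`; TT(ℓ, z) fails since GOOD fails
    have hℓ1 : 1 ≤ (c (m + 1)).r (j m) := one_le_succ_r_chart p hc hw hfloor m
    have hfail : ∃ v ∈ resVertex (c (m + 1)), v (j m) = 0 ∧ v z = 0 ∧ v ≠ 0 := by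
      by_contra hno
      push Not at hno
      refine hbad1 ⟨⟨j m, z, hoth⟩, fun x y hxy hx hy v hv hvx hvy => ?_⟩
      have hmem : ∀ u, 1 ≤ (c (m + 1)).r u → u = j m ∨ u = z := by
        intro u hu; by_contra h; push Not at h; have := hoth u h.1 h.2; omega
      rcases hmem x hx with rfl | rfl <;> rcases hmem y hy with h | h
      · exact absurd h.symm hxy
      · subst h; exact hno v hv hvx hvy
      · subst h; exact hno v hv hvy hvx
      · exact absurd h.symm hxy
    obtain ⟨w, hwV, hwℓ, hwz, hw0⟩ := hfail
    by_cases hkeptℓ : j (m + 1) ≠ j m ∧ b (m + 1) (j m) = 0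
    · -- the newborn is kept: a satellite step; `z` is kept too, SHAPE 3 next
      have hsat : FreeTail.IsSatellite j b m := hkeptℓ
      obtain ⟨hzj', hbz'⟩ := kept_of_kept_newborn p hc hw hr0 hfloor hshade he hm hwV hw0 hwℓ hwz hsat
      refine ⟨⟨hzj', hbz'⟩, Or.inr ⟨j m, j (m + 1), hkeptℓ.1.symm, hzj.symm, hzj'.symm, ?_, hnew, ?_, ?_, ?_⟩⟩
      · rw [hkeep (j m) hkeptℓ.1.symm hkeptℓ.2]; exact hℓ1
      · rw [hkeep z hzj' hbz']; exact hz1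
      · intro i hiℓ hij hiz
        exact hzero i hij (Or.inl (hoth i hiℓ hiz))
      · exact tt_of_satellite p hc hw hr0 hfloor hshade he hm hsat
    · -- the newborn is hit: then `z` must be kept (else GOOD), SHAPE 2 next
      have hℓ0 : j m ≠ j (m + 1) → (c (m + 2)).r (j m) = 0 := fun hne =>
        hzero (j m) hne (Or.inr fun hb => hkeptℓ ⟨hne.symm, hb⟩)
      have hkz : z ≠ j (m + 1) ∧ b (m + 1) z = 0 := by
        by_contra hno
        refine hbad2 (hG1 fun i hi => ?_)
        by_cases hiℓ : i = j m
        · rw [hiℓ] at hi ⊢; exact hℓ0 hi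
        · by_cases hiz : i = z
          · subst hiz
            exact hzero i hi (Or.inr fun hb => hno ⟨hi, hb⟩)
          · exact hzero i hi (Or.inl (hoth i hiℓ hiz))
      refine ⟨hkz, Or.inl ⟨hkz.1, by rw [hkeep z hkz.1 hkz.2]; exact hz1, fun i hi hiz => ?_⟩⟩
      by_cases hiℓ : i = j m
      · rw [hiℓ] at hi ⊢; exact hℓ0 hi
      · exact hzero i hi (Or.inl (hoth i hiℓ hiz))
  · -- SHAPE 3 at `m + 1`: boundary `{{a, b′, z}}` with TT(a, b′); `a` and `b′` cannot both be kept
    have hnotboth : ¬ ((a ≠ j (m + 1) ∧ b (m + 1) a = 0) ∧ (b' ≠ j (m + 1) ∧ b (m + 1) b' = 0)) := fun h =>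
      not_kept_both_of_tt p hc hw hr0 hfloor hshade hm1 hTT h.1.1 h.1.2 h.2.1 h.2.2
    -- symmetric treatment: one of `a, b′` kept and the other hit
    have hone : ∀ a b' : Fin 4, a ≠ b' → a ≠ z → b' ≠ z → 1 ≤ (c (m + 1)).r a →
        (∀ i, i ≠ a → i ≠ b' → i ≠ z → (c (m + 1)).r i = 0) →
        (∀ v ∈ resVertex (c (m + 1)), v b' = 0 → v a = 0 → v = 0) →
        (a ≠ j (m + 1) ∧ b (m + 1) a = 0) → ¬ (b' ≠ j (m + 1) ∧ b (m + 1) b' = 0) →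
        (z ≠ j (m + 1) ∧ b (m + 1) z = 0) ∧
        ((z ≠ j (m + 1) ∧ 1 ≤ (c (m + 2)).r z ∧ ∀ i, i ≠ j (m + 1) → i ≠ z → (c (m + 2)).r i = 0) ∨
      (∃ a b' : Fin 4, a ≠ b' ∧ a ≠ z ∧ b' ≠ z ∧ 1 ≤ (c (m + 2)).r a ∧ 1 ≤ (c (m + 2)).r b' ∧ 1 ≤ (c (m + 2)).r z ∧
        (∀ i, i ≠ a → i ≠ b' → i ≠ z → (c (m + 2)).r i = 0) ∧
        ∀ v ∈ resVertex (c (m + 2)), v a = 0 → v b' = 0 → v = 0)) := by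
      intro a b' hab haz hbz ha1 hoth hTT hka hkb
      have hb'hit : b' = j (m + 1) ∨ b (m + 1) b' ≠ 0 := by
        by_contra h; push Not at h; exact hkb ⟨fun h' => h.1 h', h.2⟩
      have hTT' := tt_transport_kept p hc hw hr0 hfloor hshade he hm1 (Ne.symm hab) hTT hka.1 hka.2 hb'hit
      have hb'0 : b' ≠ j (m + 1) → (c (m + 2)).r b' = 0 := fun hne => hzero b' hne (Or.inr (hb'hit.resolve_left hne))
      have hkz : z ≠ j (m + 1) ∧ b (m + 1) z = 0 := by
        by_contra hno
        refine hbad2 (hG2 a (fun i hi hia => ?_) hTT')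
        by_cases hib : i = b'
        · rw [hib] at hi ⊢; exact hb'0 hi
        · by_cases hiz : i = z
          · subst hiz; exact hzero i hi (Or.inr fun hb => hno ⟨hi, hb⟩)
          · exact hzero i hi (Or.inl (hoth i hia hib hiz))
      refine ⟨hkz, Or.inr ⟨j (m + 1), a, Ne.symm hka.1, hkz.1.symm, haz, hnew, ?_, ?_, ?_, hTT'⟩⟩
      · rw [hkeep a hka.1 hka.2]; exact ha1
      · rw [hkeep z hkz.1 hkz.2]; exact hz1
      · intro i hij hia hiz
        by_cases hib : i = b'
        · rw [hib] at hij ⊢; exact hb'0 hij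
        · exact hzero i hij (Or.inl (hoth i hia hib hiz))
    by_cases hka : a ≠ j (m + 1) ∧ b (m + 1) a = 0
    · exact hone a b' hab haz hbz ha1 hoth (fun v hv h1 h2 => hTT v hv h2 h1) hka (fun hkb => hnotboth ⟨hka, hkb⟩)
    · by_cases hkb : b' ≠ j (m + 1) ∧ b (m + 1) b' = 0
      · exact hone b' a (Ne.symm hab) hbz haz hb1 (fun i hib hia hiz => hoth i hia hib hiz) hTT hkb hka
      · -- neither kept: `z` kept (else GOOD), SHAPE 2 next
        have ha0 : a ≠ j (m + 1) → (c (m + 2)).r a = 0 := fun hne =>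
          hzero a hne (Or.inr fun hb => hka ⟨hne, hb⟩)
        have hb0 : b' ≠ j (m + 1) → (c (m + 2)).r b' = 0 := fun hne =>
          hzero b' hne (Or.inr fun hb => hkb ⟨hne, hb⟩)
        have hrest : ∀ i, i ≠ j (m + 1) → i ≠ z → (c (m + 2)).r i = 0 := by
          intro i hi hiz
          by_cases hia : i = a
          · rw [hia] at hi ⊢; exact ha0 hi
          · by_cases hib : i = b'
            · rw [hib] at hi ⊢; exact hb0 hi
            · exact hzero i hi (Or.inl (hoth i hia hib hiz))
        have hkz : z ≠ j (m + 1) ∧ b (m + 1) z = 0 := by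
          by_contra hno
          refine hbad2 (hG1 fun i hi => ?_)
          by_cases hiz : i = z
          · subst hiz; exact hzero i hi (Or.inr fun hb => hno ⟨hi, hb⟩)
          · exact hrest i hi hiz
        exact ⟨hkz, Or.inl ⟨hkz.1, by rw [hkeep z hkz.1 hkz.2]; exact hz1, hrest⟩⟩

end TT

end ResCone

end Summit.ResolutionOfSingularities.ResolutionOfSingularities.Theorems.PIDim4

end
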